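import Mathlib
import HarnessLib
import Summits.HubbardSuperconductivity.HubbardSuperconductivity.Theorems.KLProgrammeC4aUmkArcMiddleUniform
import Summits.HubbardSuperconductivity.HubbardSuperconductivity.Theorems.KLProgrammeC4aLoopPeriodization
import Summits.HubbardSuperconductivity.HubbardSuperconductivity.Theorems.KLProgrammeC4aPathRigidity

/-!
# COMPARABLE-LEVELS KERNEL PIECE `M` SIBLING (rows `hcomp`/`hKopp`/`hflatB` in place of `hsupp`/`hflat`, `qc ≥ 4`, `+ C_t`; constants of memo §17) of:
# Route `KLProgramme` — crux C4a, S3 brick (B4) «(U1)-HYBRID» part U6: THE WHOLE LOOP CIRCLE ON ANY `ϑ`-ARC for a configuration-dependent, direct-null and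
# Cooper-null loop numerator `Y ϑ e v` — `∫_arc |∫_{−hi}^{hi}∫_{v₀}^{v₀+2π} w·Y·(K e)′(ē)| dϑ ≤ J·N_t·max(b_near, ℓ·max(b_far, b_mono))`, NO margins

Cell `gate-hubbard-kl`, seat hubbard-kl-k3c3-p3 (g36; row «implicit-function / monotonicity route for μ(n)»).  Located brick for the (C)-closer lane / the (M4)
assembly of the umklapp first-order ϑ-layer (stub (C) `stub_twoLeg_curvature` of `KLRegimeEngineV17F2`, stmt-HubbardSuperconductivity-20437), memo
HOME/hubbard-kl-k3c3-p3/U1-CAUSTIC-SUP.md §19 «(U1)-NUMERATOR-ϑ» / «(U1)-HYBRID».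

WHY.  `…C4aLoopCircleArcs[MF]` sums the loop partition of unity over ONE generic arc (margins `ϑ_T`, `ϑ_C`) for a numerator `Y e v`.  Here the numerator is the
configuration-dependent `Y ϑ e v` of the first-order co-moving jet ((B3); located «(U1)-NUMERATOR-ϑ»), with the two NULL rows of the hybrid design
(`hYnull : ‖S(ϑ) − 2Φ(0,v+θ)‖ ≤ τ₁ → Y ϑ e v = 0`, `hCnull : ‖S(ϑ)‖ ≤ s₁ → Y ϑ e v = 0` — the direct sheet's tangency and Cooper parts are counted in the co-moving
KEY-LEMMA currency, not here), so the arc is ARBITRARY (U5-M `umkArc_integral_middle_le_unif`) — in particular the whole `ϑ`-circle `[0, 2π]` is ONE arc.  Mechanics verbatim from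
`…C4aLoopCircleArcs`: the bumped numerators `Y·χ_j` inherit the rows (`abs_mul_bump_le` / `abs_deriv_mul_bump_le` / `tsupport_mul_subset_right`; the null rows trivially),
the loop circle is the sum of the windows at every `(ϑ, e)` (`intervalIntegral_period_eq_sum_windows`, periodicity in `v`), `F_circle ≤ ∑_j F_j` pointwise, integrate.
* **`umkLoopCircle_integral_middle_le`** (HEADLINE).
Sizes binder shape + `FrameOK`/`GeomConstants` + `KlwjCertB`; nothing asserts (C), K3 or superconductivity.
References: FST II CPAM 51 (1998) §3 [cite: FeldmanSalmhoferTrubowitz1998]; BGM 2006 §2.4 [cite: BenfattoGiulianiMastropietro2006].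
-/


noncomputable section

namespace Summit.HubbardSuperconductivity.HubbardSuperconductivity.Theorems.C4a

set_option linter.dupNamespace false -- summit = problem name (single-conjunct summit), D-0017

open Real Set MeasureTheory intervalIntegral
open Literature.MathematicalPhysics.QuantumLattice Literature.MathematicalPhysics.QuantumLattice.BandSectorCounting
open Literature.MathematicalPhysics.QuantumLattice.FermiRG
open Summit.HubbardSuperconductivity.HubbardSuperconductivity.Theorems.KLRegimeSplit
open Summit.HubbardSuperconductivity.HubbardSuperconductivity.Theorems.DispersionFlow
open Summit.HubbardSuperconductivity.HubbardSuperconductivity.Theorems.PerturbedFermiCurve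

section Sizes

variable {K : TrigPolyC4v} {A : ℝ} (hA : ∀ p : Momentum, ∀ j ≤ 2, ‖iteratedFDeriv ℝ j (frameShift K) p‖ ≤ A) (hA20 : A ≤ 1 / 20)
  (hd : klCurveD ≤ (bandBounds (show (-4 : ℝ) < -1.1 by norm_num) (show (-1.1 : ℝ) ≤ -0.1 by norm_num)
    (show (-0.1 : ℝ) < 0 by norm_num)).Dtmin - 2 * A)
  {μ r : ℝ} (hr : 0 < r) (hlo : (-1.1 : ℝ) < μ - r - A) (hhi : μ + r + A < -0.1)
  {A₃ A₄ : ℝ} (hA₃ : ∀ p : Momentum, ‖iteratedFDeriv ℝ 3 (frameShift K) p‖ ≤ A₃)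
  (hA₄ : ∀ p : Momentum, ‖iteratedFDeriv ℝ 4 (frameShift K) p‖ ≤ A₄)
  {K₁ K₂ K₃ : ℝ} (hK₁ : ∀ p : Momentum, ‖fderiv ℝ (frameLevel μ K) p‖ ≤ K₁) (hK₂ : ∀ p : Momentum, ‖iteratedFDeriv ℝ 2 (frameLevel μ K) p‖ ≤ K₂)
  (hK₃ : ∀ p : Momentum, ‖iteratedFDeriv ℝ 3 (frameLevel μ K) p‖ ≤ K₃)
include hA hA20 hd hr hlo hhi hA₃ hA₄ hK₁ hK₂ hK₃

set_option maxHeartbeats 800000 in -- one `gcongr` over the written-out bound (window length `≤ L`) per window + the assembly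
/-- **THE WHOLE LOOP CIRCLE ON ANY `ϑ`-ARC, HYBRID FORM** (HEADLINE; see the module docstring): for a configuration-dependent loop numerator `Y ϑ e v` with the
direct-null and Cooper-null rows and a bump family `χ_j` (`j < J`, windows of length `≤ L`), `∫_arc |∫∫_{loop circle} w·Y·(K e)′(ē)| dϑ ≤ J·N_t·b(L)` with U5's per-window
bound `b(L)`; no tangency margin, no Cooper margin. -/
theorem umkLoopCircle_integral_middle_le {R : RenConsts} {U : ℝ} {N : ℕ} (hF : FrameOK R U N μ K) {Kc r₀ g₀ w : ℝ} (hG : GeomConstants (frameLevel μ K) Kc r₀ g₀ w)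
    {ρ : ℝ} (hρ : |ρ| < r) (hρ₀ : |ρ| < 3 / 80) (θ : ℝ) {Nt J : ℕ} {χ : ℕ → ℝ → ℝ} {φa φb : ℕ → ℝ}
    {α₀ ℓ v₀ L B₁ τ₀ lo hi Wφ Wm qc Δ K₀ Y₀ Y₁ YL W Afl Bfl Dfl Mρ Γ Γ' η₀ Δc ω d₁ lam eps κ₀ s₀ τ₁ s₁ Ct : ℝ} {Kr : ℝ → ℝ → ℝ} {Y : ℝ → ℝ → ℝ → ℝ} {wt ρm : ℝ → ℝ}
    (hℓ : 0 ≤ ℓ) (hWm : 0 ≤ Wm) (hMρ : 0 ≤ Mρ)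
    (hmod : K₃ * (τ₀ + msD A₃ A₄ 1 * (ℓ) +
              hi / ((bandBounds (show (-4 : ℝ) < -1.1 by norm_num) (show (-1.1 : ℝ) ≤ -0.1 by norm_num) (show (-0.1 : ℝ) < 0 by norm_num)).Dtmin - 2 * A) +
              msD A₃ A₄ 1 * Wφ) * msD A₃ A₄ 1 ^ 2 +
          K₂ * (radialRowOneConst A ((bandBounds (show (-4 : ℝ) < -1.1 by norm_num) (show (-1.1 : ℝ) ≤ -0.1 by norm_num) (show (-0.1 : ℝ) < 0 by norm_num)).Dtmin -
                2 * A) * hi + msD A₃ A₄ 2 * Wφ) * (msD A₃ A₄ 1 + msD A₃ A₄ 1) +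
          K₂ * (τ₀ + msD A₃ A₄ 1 * (ℓ) +
              hi / ((bandBounds (show (-4 : ℝ) < -1.1 by norm_num) (show (-1.1 : ℝ) ≤ -0.1 by norm_num) (show (-0.1 : ℝ) < 0 by norm_num)).Dtmin - 2 * A) +
              msD A₃ A₄ 1 * Wφ) * msD A₃ A₄ 2 +
          K₁ * ((uRowTwoConst A A₃ ((bandBounds (show (-4 : ℝ) < -1.1 by norm_num) (show (-1.1 : ℝ) ≤ -0.1 by norm_num) (show (-0.1 : ℝ) < 0 by norm_num)).Dtmin -
                  2 * A) +
                1 / ((bandBounds (show (-4 : ℝ) < -1.1 by norm_num) (show (-1.1 : ℝ) ≤ -0.1 by norm_num) (show (-0.1 : ℝ) < 0 by norm_num)).Dtmin - 2 * A) +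
                2 * (radialRowOneConst A ((bandBounds (show (-4 : ℝ) < -1.1 by norm_num) (show (-1.1 : ℝ) ≤ -0.1 by norm_num)
                    (show (-0.1 : ℝ) < 0 by norm_num)).Dtmin - 2 * A) -
                  1 / ((bandBounds (show (-4 : ℝ) < -1.1 by norm_num) (show (-1.1 : ℝ) ≤ -0.1 by norm_num) (show (-0.1 : ℝ) < 0 by norm_num)).Dtmin - 2 * A))) *
              hi + msD A₃ A₄ 3 * Wφ) ≤
        w * (bandBounds (show (-4 : ℝ) < -1.1 by norm_num) (show (-1.1 : ℝ) ≤ -0.1 by norm_num) (show (-0.1 : ℝ) < 0 by norm_num)).umin ^ 2)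
    (hsl : K₂ * msD A₃ A₄ 1 * (τ₀ + msD A₃ A₄ 1 * (ℓ) +
        2 * (hi / ((bandBounds (show (-4 : ℝ) < -1.1 by norm_num) (show (-1.1 : ℝ) ≤ -0.1 by norm_num) (show (-0.1 : ℝ) < 0 by norm_num)).Dtmin - 2 * A))) ≤
      w * (bandBounds (show (-4 : ℝ) < -1.1 by norm_num) (show (-1.1 : ℝ) ≤ -0.1 by norm_num) (show (-0.1 : ℝ) < 0 by norm_num)).umin ^ 2 * Wm)
    (hrt : K₂ * (τ₀ + msD A₃ A₄ 1 * (ℓ) +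
          2 * (hi / ((bandBounds (show (-4 : ℝ) < -1.1 by norm_num) (show (-1.1 : ℝ) ≤ -0.1 by norm_num) (show (-0.1 : ℝ) < 0 by norm_num)).Dtmin - 2 * A) +
            msD A₃ A₄ 1 * Wφ)) /
        ((bandBounds (show (-4 : ℝ) < -1.1 by norm_num) (show (-1.1 : ℝ) ≤ -0.1 by norm_num) (show (-0.1 : ℝ) < 0 by norm_num)).Dtmin - 2 * A) ≤ 1 / 2)
    (hlo0 : 0 < lo) (hlohi : lo ≤ hi) (hhir : hi < r) (hqc : 4 ≤ qc) (hCt : 0 ≤ Ct) (hW : 0 ≤ W) (hAfl : 0 ≤ Afl) (hBfl : 0 ≤ Bfl)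
    (hK₀ : ∀ p : Momentum, |frameLevel μ K p| ≤ K₀) (hK₀pos : 0 < K₀) (hΓ₁ : K₀ ≤ Γ) (hΓ₂ : hi / 2 ≤ Γ) (hΓ'₁ : K₀ ≤ Γ')
    (hΔ : τ₀ + msD A₃ A₄ 1 * (ℓ) + 2 * (msD A₃ A₄ 1 * Wφ) ≤ Δ) (hΔ1 : Δ ≤ 3 / 10) (hΔu : Δ ≤ (bandBounds (show (-4 : ℝ) < -1.1 by norm_num) (show (-1.1 : ℝ) ≤ -0.1 by norm_num) (show (-0.1 : ℝ) < 0 by norm_num)).umin) (hΔr : K₁ * Δ < r) (hDfl : K₁ * Δ ≤ Dfl)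
    (hKd : ∀ e ∈ Icc (-hi) hi, ContDiff ℝ 1 (Kr e)) (hK2d : ∀ e ∈ Icc lo hi, ContDiff ℝ 2 (Kr e))
    (hK0 : ∀ e ∈ Icc (-hi) hi, e ≠ 0 → ∀ u, |Kr e u| ≤ (max |e| |u|)⁻¹) (hK0s : ∀ e ∈ Icc (-lo) lo, ∀ u, |Kr e u| ≤ (max lo |u|)⁻¹)
    (hK1 : ∀ e ∈ Icc (-hi) hi, e ≠ 0 → ∀ u, |deriv (Kr e) u| ≤ (max |e| |u|)⁻¹ ^ 2)
    (hK2 : ∀ e ∈ Icc lo hi, ∀ u, |iteratedDeriv 2 (Kr e) u| ≤ (max e |u|)⁻¹ ^ 3)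
    (hcomp : ∀ e ∈ Icc lo hi, ∀ u, qc * e ≤ |u| → deriv (Kr e) u = 0)
    (hKopp : ∀ e ∈ Icc lo hi, ∀ u, u ≤ -(e / 4) → |deriv (Kr e) u| ≤ Ct * lo * (max e |u|)⁻¹ ^ 3)
    (hKc : Continuous fun p : ℝ × ℝ => deriv (Kr p.1) p.2)
    (hflatB : ∀ D : ℝ, 0 < D → D ≤ Dfl →
      |∫ e in (max lo (D / (qc + 3 / 2)))..(min hi (4 * D)), wt e * deriv (Kr e) (D - e)| ≤ Afl * (lo / (max D lo) ^ 2) + Bfl)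
    (hKn1 : ∀ s ∈ Icc lo hi, ∀ u, s / 2 ≤ u → |deriv (Kr (-s)) u| ≤ ρm s * ((max (u - s) lo)⁻¹ ^ 2))
    (hρ0 : ∀ s ∈ Icc lo hi, 0 ≤ ρm s) (hρc : ContinuousOn ρm (Icc lo hi))
    (hρtail : ∀ a ∈ Icc lo hi, ∫ s in a..hi, ρm s ≤ Mρ * (lo * (lo / a) ^ 2))
    (hKs1 : ∀ e ∈ Icc (-lo) lo, ∀ u, |deriv (Kr e) u| ≤ (max lo |u|)⁻¹ ^ 2)
   
   
    (hwc : ContinuousOn wt (Icc (-hi) hi)) (hw0 : ∀ e ∈ Icc (-hi) hi, 0 ≤ wt e) (hwW : ∀ e ∈ Icc (-hi) hi, wt e ≤ W)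
    (hsame : τ₀ + 2 * (msD A₃ A₄ 1 * η₀ + |ρ| / ((bandBounds (show (-4 : ℝ) < -1.1 by norm_num) (show (-1.1 : ℝ) ≤ -0.1 by norm_num) (show (-0.1 : ℝ) < 0 by norm_num)).Dtmin - 2 * A)) ≤ 3 / 5)
    (hΔc1 : Δc ≤ 3 / 10) (hΔcr : K₁ * Δc < r) (hω₁ : η₀ + (ℓ) ≤ ω)
    (hΓ : 2 / π * (((bandBounds (show (-4 : ℝ) < -1.1 by norm_num) (show (-1.1 : ℝ) ≤ -0.1 by norm_num) (show (-0.1 : ℝ) < 0 by norm_num)).Dtmin - 2 * A) * (bandBounds (show (-4 : ℝ) < -1.1 by norm_num) (show (-1.1 : ℝ) ≤ -0.1 by norm_num) (show (-0.1 : ℝ) < 0 by norm_num)).umin) *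
      ((bandBounds (show (-4 : ℝ) < -1.1 by norm_num) (show (-1.1 : ℝ) ≤ -0.1 by norm_num) (show (-0.1 : ℝ) < 0 by norm_num)).umin * (3 / 200) / (4 + 2 * A) * (η₀ - (ℓ) - π / (2 * (bandBounds (show (-4 : ℝ) < -1.1 by norm_num) (show (-1.1 : ℝ) ≤ -0.1 by norm_num) (show (-0.1 : ℝ) < 0 by norm_num)).umin) * Δc) - π * 7 * (K₁ * Δc + |ρ|) / ((bandBounds (show (-4 : ℝ) < -1.1 by norm_num) (show (-1.1 : ℝ) ≤ -0.1 by norm_num) (show (-0.1 : ℝ) < 0 by norm_num)).Dtmin - 2 * A) ^ 2) * (ℓ) ≤ Γ)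
    (hhir₀ : hi < r₀) (hhiK : hi ≤ K₀) (hd₁ : 0 < d₁) (hlam : 0 < lam)
    (hhid : K₁ * (hi / ((bandBounds (show (-4 : ℝ) < -1.1 by norm_num) (show (-1.1 : ℝ) ≤ -0.1 by norm_num) (show (-0.1 : ℝ) < 0 by norm_num)).Dtmin - 2 * A)) ≤ d₁ / 2)
    (hepsr : eps ≤ r)
    (hT : KlwjCertB)
    (hτ₀ : msD A₃ A₄ 1 *
            ((π / 2 * lam /
                  (((bandBounds (show (-4 : ℝ) < -1.1 by norm_num) (show (-1.1 : ℝ) ≤ -0.1 by norm_num) (show (-0.1 : ℝ) < 0 by norm_num)).Dtmin -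
                      2 * A) *
                    (bandBounds (show (-4 : ℝ) < -1.1 by norm_num) (show (-1.1 : ℝ) ≤ -0.1 by norm_num) (show (-0.1 : ℝ) < 0 by norm_num)).umin) +
                π * Kc * eps / ((bandBounds (show (-4 : ℝ) < -1.1 by norm_num) (show (-1.1 : ℝ) ≤ -0.1 by norm_num) (show (-0.1 : ℝ) < 0 by norm_num)).Dtmin - 2 * A) ^ 2) /
              ((bandBounds (show (-4 : ℝ) < -1.1 by norm_num) (show (-1.1 : ℝ) ≤ -0.1 by norm_num) (show (-0.1 : ℝ) < 0 by norm_num)).umin * w /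
                (4 + 2 * A))) +
          (2 * hi + eps) / ((bandBounds (show (-4 : ℝ) < -1.1 by norm_num) (show (-1.1 : ℝ) ≤ -0.1 by norm_num) (show (-0.1 : ℝ) < 0 by norm_num)).Dtmin -
            2 * A) ≤ τ₀)
    (hκ₀ : 0 < κ₀) (hκ₀le : κ₀ ≤ 2 / π * (((bandBounds (show (-4 : ℝ) < -1.1 by norm_num) (show (-1.1 : ℝ) ≤ -0.1 by norm_num) (show (-0.1 : ℝ) < 0 by norm_num)).Dtmin - 2 * A) * (bandBounds (show (-4 : ℝ) < -1.1 by norm_num) (show (-1.1 : ℝ) ≤ -0.1 by norm_num) (show (-0.1 : ℝ) < 0 by norm_num)).umin) *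
      ((bandBounds (show (-4 : ℝ) < -1.1 by norm_num) (show (-1.1 : ℝ) ≤ -0.1 by norm_num) (show (-0.1 : ℝ) < 0 by norm_num)).umin * (3 / 200) / (4 + 2 * A) * (η₀ - (ℓ) - π / (2 * (bandBounds (show (-4 : ℝ) < -1.1 by norm_num) (show (-1.1 : ℝ) ≤ -0.1 by norm_num) (show (-0.1 : ℝ) < 0 by norm_num)).umin) * Δc) - π * 7 * (K₁ * Δc + |ρ|) / ((bandBounds (show (-4 : ℝ) < -1.1 by norm_num) (show (-1.1 : ℝ) ≤ -0.1 by norm_num) (show (-0.1 : ℝ) < 0 by norm_num)).Dtmin - 2 * A) ^ 2))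
    (hs₀ : 0 < s₀) (hs₀le : s₀ ≤ 9 / 400 * (bandBounds (show (-4 : ℝ) < -1.1 by norm_num) (show (-1.1 : ℝ) ≤ -0.1 by norm_num) (show (-0.1 : ℝ) < 0 by norm_num)).umin ^ 2 - 2 * (2 * K₃ * Δc * msD A₃ A₄ 1 ^ 2 +
        4 * K₂ * (radialRowOneConst A ((bandBounds (show (-4 : ℝ) < -1.1 by norm_num) (show (-1.1 : ℝ) ≤ -0.1 by norm_num) (show (-0.1 : ℝ) < 0 by norm_num)).Dtmin - 2 * A) * |ρ| + msD A₃ A₄ 2 * ω) * msD A₃ A₄ 1 +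
        K₂ * Δc * msD A₃ A₄ 2 +
        K₁ * ((uRowTwoConst A A₃ ((bandBounds (show (-4 : ℝ) < -1.1 by norm_num) (show (-1.1 : ℝ) ≤ -0.1 by norm_num) (show (-0.1 : ℝ) < 0 by norm_num)).Dtmin - 2 * A) + 1 / ((bandBounds (show (-4 : ℝ) < -1.1 by norm_num) (show (-1.1 : ℝ) ≤ -0.1 by norm_num) (show (-0.1 : ℝ) < 0 by norm_num)).Dtmin - 2 * A) +
              2 * (radialRowOneConst A ((bandBounds (show (-4 : ℝ) < -1.1 by norm_num) (show (-1.1 : ℝ) ≤ -0.1 by norm_num) (show (-0.1 : ℝ) < 0 by norm_num)).Dtmin - 2 * A) - 1 / ((bandBounds (show (-4 : ℝ) < -1.1 by norm_num) (show (-1.1 : ℝ) ≤ -0.1 by norm_num) (show (-0.1 : ℝ) < 0 by norm_num)).Dtmin - 2 * A))) * |ρ| + msD A₃ A₄ 3 * ω)))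
    (hτ₁ : τ₀ + msD A₃ A₄ 1 * (ℓ + 2 * L) ≤ τ₁)
    (hYnull : ∀ ϑ ∈ Icc α₀ (α₀ + Nt * ℓ), ∀ e ∈ Icc (-hi) hi, ∀ v, ‖pairSumPath μ K ρ ϑ θ 0 - (2 : ℝ) • levelPoint μ K 0 (v + θ)‖ ≤ τ₁ → Y ϑ e v = 0)
    (hs₁ : msD A₃ A₄ 1 *
            ((π / 2 * lam /
                  (((bandBounds (show (-4 : ℝ) < -1.1 by norm_num) (show (-1.1 : ℝ) ≤ -0.1 by norm_num) (show (-0.1 : ℝ) < 0 by norm_num)).Dtmin -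
                      2 * A) *
                    (bandBounds (show (-4 : ℝ) < -1.1 by norm_num) (show (-1.1 : ℝ) ≤ -0.1 by norm_num) (show (-0.1 : ℝ) < 0 by norm_num)).umin) +
                π * Kc * eps / ((bandBounds (show (-4 : ℝ) < -1.1 by norm_num) (show (-1.1 : ℝ) ≤ -0.1 by norm_num) (show (-0.1 : ℝ) < 0 by norm_num)).Dtmin - 2 * A) ^ 2) /
              ((bandBounds (show (-4 : ℝ) < -1.1 by norm_num) (show (-1.1 : ℝ) ≤ -0.1 by norm_num) (show (-0.1 : ℝ) < 0 by norm_num)).umin * w /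
                (4 + 2 * A))) +
          eps / ((bandBounds (show (-4 : ℝ) < -1.1 by norm_num) (show (-1.1 : ℝ) ≤ -0.1 by norm_num) (show (-0.1 : ℝ) < 0 by norm_num)).Dtmin - 2 * A) + msD A₃ A₄ 1 * ℓ ≤ s₁)
    (hCnull : ∀ ϑ ∈ Icc α₀ (α₀ + Nt * ℓ), ∀ e ∈ Icc (-hi) hi, ∀ v, ‖pairSumPath μ K ρ ϑ θ 0‖ ≤ s₁ → Y ϑ e v = 0)
    (hWφ : L + 2 * Wm ≤ Wφ) (hΓ'₂ : w * (bandBounds (show (-4 : ℝ) < -1.1 by norm_num) (show (-1.1 : ℝ) ≤ -0.1 by norm_num) (show (-0.1 : ℝ) < 0 by norm_num)).umin ^ 2 / 2 * (L + 2 * Wm) ^ 2 ≤ Γ')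
    (hΔc : τ₀ + msD A₃ A₄ 1 * ((ℓ) + (L + 2 * Wm)) ≤ Δc) (hω₂ : L + 2 * Wm ≤ ω)
    (heps : d₁ + K₁ * (msD A₃ A₄ 1 * (L)) + K₁ * (hi / ((bandBounds (show (-4 : ℝ) < -1.1 by norm_num) (show (-1.1 : ℝ) ≤ -0.1 by norm_num) (show (-0.1 : ℝ) < 0 by norm_num)).Dtmin - 2 * A)) + hi ≤ eps)
    (hwin : ∀ j < J, φa j ≤ φb j ∧ φb j - φa j ≤ L) (hwinI : ∀ j < J, Ioo (φa j) (φb j) ⊆ Ioo (v₀ - 2 * π) (v₀ + 4 * π))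
    (hχd : ∀ j < J, ContDiff ℝ 1 (χ j)) (hχs : ∀ j < J, tsupport (χ j) ⊆ Ioo (φa j) (φb j)) (hχb : ∀ j < J, ∀ v, |χ j v| ≤ 1)
    (hχ1 : ∀ j < J, ∀ v, |deriv (χ j) v| ≤ B₁) (hB₁ : 0 ≤ B₁)
    (hsum : ∀ v ∈ Icc v₀ (v₀ + 2 * π), ∑ j ∈ Finset.range J, (χ j v + χ j (v + 2 * π) + χ j (v - 2 * π)) = 1)
    (hY₀ : 0 ≤ Y₀) (hY₁ : 0 ≤ Y₁) (hYL : 0 ≤ YL) (hYd : ∀ ϑ, ∀ e ∈ Icc (-hi) hi, ContDiff ℝ 1 (Y ϑ e))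
    (hY3 : ContinuousOn (fun p : ℝ × ℝ × ℝ => Y p.1 p.2.1 p.2.2) (univ ×ˢ (Icc (-hi) hi ×ˢ univ)))
    (hYb : ∀ ϑ, ∀ e ∈ Icc (-hi) hi, ∀ v, |Y ϑ e v| ≤ Y₀) (hY1 : ∀ ϑ, ∀ e ∈ Icc (-hi) hi, ∀ v, |deriv (Y ϑ e) v| ≤ Y₁)
    (hYLip : ∀ ϑ, ∀ e ∈ Icc lo hi, ∀ v, |Y ϑ e v - Y ϑ lo v| ≤ YL * |e - lo|) (hYper : ∀ ϑ, ∀ e ∈ Icc (-hi) hi, ∀ v, Y ϑ e (v + 2 * π) = Y ϑ e v) :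
    ∫ ϑ in α₀..(α₀ + Nt * ℓ), |∫ e in (-hi)..hi, ∫ v in v₀..(v₀ + 2 * π), wt e * (Y ϑ e v * deriv (Kr e) (frameLevel μ K (pairSumPath μ K ρ ϑ θ 0 - levelPoint μ K e (v + θ))))| ≤ (J : ℝ) * ((Nt : ℝ) * max (max (2 * ((2 * (      3 * W * ((4 + 2 * (3 / 2 : ℝ) + 1 / 2) / (1 / 2)) *
          (Y₀ * (4 / Real.sqrt (2 * (K₂ * msD A₃ A₄ 1 ^ 2) +
                    w * (bandBounds (show (-4 : ℝ) < -1.1 by norm_num) (show (-1.1 : ℝ) ≤ -0.1 by norm_num) (show (-0.1 : ℝ) < 0 by norm_num)).umin ^ 2) +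
                  16 * Real.sqrt (2 * (K₂ * msD A₃ A₄ 1 ^ 2) +
                        w * (bandBounds (show (-4 : ℝ) < -1.1 by norm_num) (show (-1.1 : ℝ) ≤ -0.1 by norm_num) (show (-0.1 : ℝ) < 0 by norm_num)).umin ^ 2) /
                      (w * (bandBounds (show (-4 : ℝ) < -1.1 by norm_num) (show (-1.1 : ℝ) ≤ -0.1 by norm_num) (show (-0.1 : ℝ) < 0 by norm_num)).umin ^ 2) +
                  64 * (2 * (K₂ * msD A₃ A₄ 1 ^ 2) +
                          w * (bandBounds (show (-4 : ℝ) < -1.1 by norm_num) (show (-1.1 : ℝ) ≤ -0.1 by norm_num) (show (-0.1 : ℝ) < 0 by norm_num)).umin ^ 2) ^ 2 *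
                      Real.sqrt (2 * (K₂ * msD A₃ A₄ 1 ^ 2) +
                          w * (bandBounds (show (-4 : ℝ) < -1.1 by norm_num) (show (-1.1 : ℝ) ≤ -0.1 by norm_num) (show (-0.1 : ℝ) < 0 by norm_num)).umin ^ 2) /
                    (w * (bandBounds (show (-4 : ℝ) < -1.1 by norm_num) (show (-1.1 : ℝ) ≤ -0.1 by norm_num) (show (-0.1 : ℝ) < 0 by norm_num)).umin ^ 2) ^ 3) *
              Real.sqrt (4 + 2 * (3 / 2 : ℝ) + 1 / 2) +
            32 * (Y₁ + Y₀ * B₁) * (2 * (K₂ * msD A₃ A₄ 1 ^ 2) +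
                  w * (bandBounds (show (-4 : ℝ) < -1.1 by norm_num) (show (-1.1 : ℝ) ≤ -0.1 by norm_num) (show (-0.1 : ℝ) < 0 by norm_num)).umin ^ 2) /
              (w * (bandBounds (show (-4 : ℝ) < -1.1 by norm_num) (show (-1.1 : ℝ) ≤ -0.1 by norm_num) (show (-0.1 : ℝ) < 0 by norm_num)).umin ^ 2) ^ 2))) * max 1 (Real.sqrt (κ₀))⁻¹ * (81 * (Γ / (κ₀)) ^ (1 / 4 : ℝ)) *
          ((ℓ) ^ (3 / 4 : ℝ) / (3 / 4) + (ℓ) ^ (1 / 4 : ℝ) / (1 / 4))))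
      ((8 * (32 * (Y₀ * Afl + W * Y₀ * Ct + 5 * (W * Y₀ * Mρ) + 32 * (W * Y₀)) / (3 * Real.sqrt (w * (bandBounds (show (-4 : ℝ) < -1.1 by norm_num) (show (-1.1 : ℝ) ≤ -0.1 by norm_num) (show (-0.1 : ℝ) < 0 by norm_num)).umin ^ 2 / 2))) + 4 * (2 * (      W * (Y₀ * (4 / Real.sqrt (2 * (K₂ * msD A₃ A₄ 1 ^ 2) +
                    w * (bandBounds (show (-4 : ℝ) < -1.1 by norm_num) (show (-1.1 : ℝ) ≤ -0.1 by norm_num) (show (-0.1 : ℝ) < 0 by norm_num)).umin ^ 2) + 16 * Real.sqrt (2 * (K₂ * msD A₃ A₄ 1 ^ 2) +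
                    w * (bandBounds (show (-4 : ℝ) < -1.1 by norm_num) (show (-1.1 : ℝ) ≤ -0.1 by norm_num) (show (-0.1 : ℝ) < 0 by norm_num)).umin ^ 2) / (w * (bandBounds (show (-4 : ℝ) < -1.1 by norm_num) (show (-1.1 : ℝ) ≤ -0.1 by norm_num) (show (-0.1 : ℝ) < 0 by norm_num)).umin ^ 2) + 64 * (2 * (K₂ * msD A₃ A₄ 1 ^ 2) +
                    w * (bandBounds (show (-4 : ℝ) < -1.1 by norm_num) (show (-1.1 : ℝ) ≤ -0.1 by norm_num) (show (-0.1 : ℝ) < 0 by norm_num)).umin ^ 2) ^ 2 * Real.sqrt (2 * (K₂ * msD A₃ A₄ 1 ^ 2) +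
                    w * (bandBounds (show (-4 : ℝ) < -1.1 by norm_num) (show (-1.1 : ℝ) ≤ -0.1 by norm_num) (show (-0.1 : ℝ) < 0 by norm_num)).umin ^ 2) / (w * (bandBounds (show (-4 : ℝ) < -1.1 by norm_num) (show (-1.1 : ℝ) ≤ -0.1 by norm_num) (show (-0.1 : ℝ) < 0 by norm_num)).umin ^ 2) ^ 3 +
              2 * Real.sqrt (w * (bandBounds (show (-4 : ℝ) < -1.1 by norm_num) (show (-1.1 : ℝ) ≤ -0.1 by norm_num) (show (-0.1 : ℝ) < 0 by norm_num)).umin ^ 2) / (w * (bandBounds (show (-4 : ℝ) < -1.1 by norm_num) (show (-1.1 : ℝ) ≤ -0.1 by norm_num) (show (-0.1 : ℝ) < 0 by norm_num)).umin ^ 2) + (2 * (K₂ * msD A₃ A₄ 1 ^ 2) +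
                    w * (bandBounds (show (-4 : ℝ) < -1.1 by norm_num) (show (-1.1 : ℝ) ≤ -0.1 by norm_num) (show (-0.1 : ℝ) < 0 by norm_num)).umin ^ 2) * Real.sqrt (w * (bandBounds (show (-4 : ℝ) < -1.1 by norm_num) (show (-1.1 : ℝ) ≤ -0.1 by norm_num) (show (-0.1 : ℝ) < 0 by norm_num)).umin ^ 2) / (w * (bandBounds (show (-4 : ℝ) < -1.1 by norm_num) (show (-1.1 : ℝ) ≤ -0.1 by norm_num) (show (-0.1 : ℝ) < 0 by norm_num)).umin ^ 2) ^ 2) +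
            (Y₁ + Y₀ * B₁) * (32 * (2 * (K₂ * msD A₃ A₄ 1 ^ 2) +
                    w * (bandBounds (show (-4 : ℝ) < -1.1 by norm_num) (show (-1.1 : ℝ) ≤ -0.1 by norm_num) (show (-0.1 : ℝ) < 0 by norm_num)).umin ^ 2) * Real.sqrt (K₀ + hi) / (w * (bandBounds (show (-4 : ℝ) < -1.1 by norm_num) (show (-1.1 : ℝ) ≤ -0.1 by norm_num) (show (-0.1 : ℝ) < 0 by norm_num)).umin ^ 2) ^ 2 + (L + 2 * Wm) * Real.sqrt (w * (bandBounds (show (-4 : ℝ) < -1.1 by norm_num) (show (-1.1 : ℝ) ≤ -0.1 by norm_num) (show (-0.1 : ℝ) < 0 by norm_num)).umin ^ 2) / (w * (bandBounds (show (-4 : ℝ) < -1.1 by norm_num) (show (-1.1 : ℝ) ≤ -0.1 by norm_num) (show (-0.1 : ℝ) < 0 by norm_num)).umin ^ 2))) *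
          ((4 + 2 * (3 / 2 : ℝ) + 1 / 2) * Real.sqrt (4 + 2 * (3 / 2 : ℝ) + 1 / 2) *
                ((1 + Real.log 2 + log⁺ ((1 + 4 * (2 * (K₂ * msD A₃ A₄ 1 ^ 2) +
                    w * (bandBounds (show (-4 : ℝ) < -1.1 by norm_num) (show (-1.1 : ℝ) ≤ -0.1 by norm_num) (show (-0.1 : ℝ) < 0 by norm_num)).umin ^ 2) / (w * (bandBounds (show (-4 : ℝ) < -1.1 by norm_num) (show (-1.1 : ℝ) ≤ -0.1 by norm_num) (show (-0.1 : ℝ) < 0 by norm_num)).umin ^ 2)) * (1 + (3 / 2 : ℝ))) + log⁺ (1 + 4 * (2 * (K₂ * msD A₃ A₄ 1 ^ 2) +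
                    w * (bandBounds (show (-4 : ℝ) < -1.1 by norm_num) (show (-1.1 : ℝ) ≤ -0.1 by norm_num) (show (-0.1 : ℝ) < 0 by norm_num)).umin ^ 2) / (w * (bandBounds (show (-4 : ℝ) < -1.1 by norm_num) (show (-1.1 : ℝ) ≤ -0.1 by norm_num) (show (-0.1 : ℝ) < 0 by norm_num)).umin ^ 2))) + 4) +
            2 * (1 + Real.log 2 + log⁺ ((1 + 4 * (2 * (K₂ * msD A₃ A₄ 1 ^ 2) +
                    w * (bandBounds (show (-4 : ℝ) < -1.1 by norm_num) (show (-1.1 : ℝ) ≤ -0.1 by norm_num) (show (-0.1 : ℝ) < 0 by norm_num)).umin ^ 2) / (w * (bandBounds (show (-4 : ℝ) < -1.1 by norm_num) (show (-1.1 : ℝ) ≤ -0.1 by norm_num) (show (-0.1 : ℝ) < 0 by norm_num)).umin ^ 2)) * (1 + (3 / 2 : ℝ))) + log⁺ (1 + 4 * (2 * (K₂ * msD A₃ A₄ 1 ^ 2) +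
                    w * (bandBounds (show (-4 : ℝ) < -1.1 by norm_num) (show (-1.1 : ℝ) ≤ -0.1 by norm_num) (show (-0.1 : ℝ) < 0 by norm_num)).umin ^ 2) / (w * (bandBounds (show (-4 : ℝ) < -1.1 by norm_num) (show (-1.1 : ℝ) ≤ -0.1 by norm_num) (show (-0.1 : ℝ) < 0 by norm_num)).umin ^ 2))) *
              ((4 + 2 * (3 / 2 : ℝ) + 1 / 2) / (1 / 2) * Real.sqrt ((4 + 2 * (3 / 2 : ℝ) + 1 / 2) / (1 / 2))))))) / Real.sqrt ((s₀) / 2) + (((16 * (qc + 3 / 2) ^ 3 * W * Y₀ * (K₂ / ((bandBounds (show (-4 : ℝ) < -1.1 by norm_num) (show (-1.1 : ℝ) ≤ -0.1 by norm_num) (show (-0.1 : ℝ) < 0 by norm_num)).Dtmin - 2 * A)) * (1 / ((bandBounds (show (-4 : ℝ) < -1.1 by norm_num) (show (-1.1 : ℝ) ≤ -0.1 by norm_num) (show (-0.1 : ℝ) < 0 by norm_num)).Dtmin - 2 * A) + msD A₃ A₄ 1 * (π * (4 + 2 * A) * Kc / ((bandBounds (show (-4 : ℝ) < -1.1 by norm_num)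 (show (-1.1 : ℝ) ≤ -0.1 by norm_num) (show (-0.1 : ℝ) < 0 by norm_num)).umin * w * ((bandBounds (show (-4 : ℝ) < -1.1 by norm_num) (show (-1.1 : ℝ) ≤ -0.1 by norm_num) (show (-0.1 : ℝ) < 0 by norm_num)).Dtmin - 2 * A) ^ 2))) + 128 * (qc + 3 / 2) ^ 3 * W * Y₀ * (K₂ / ((bandBounds (show (-4 : ℝ) < -1.1 by norm_num) (show (-1.1 : ℝ) ≤ -0.1 by norm_num) (show (-0.1 : ℝ) < 0 by norm_num)).Dtmin - 2 * A) ^ 2) + 16 * (qc + 3 / 2) ^ 2 * W * YL + Y₀ * Bfl) * (L + 2 * Wm) +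
          8 * (32 * (qc + 3 / 2) ^ 3 * W * Y₀ * (K₂ / ((bandBounds (show (-4 : ℝ) < -1.1 by norm_num) (show (-1.1 : ℝ) ≤ -0.1 by norm_num) (show (-0.1 : ℝ) < 0 by norm_num)).Dtmin - 2 * A)) * msD A₃ A₄ 1) /
            (w * (bandBounds (show (-4 : ℝ) < -1.1 by norm_num) (show (-1.1 : ℝ) ≤ -0.1 by norm_num) (show (-0.1 : ℝ) < 0 by norm_num)).umin ^ 2 / 2) * Real.log 2)) * (ℓ) +
        (4 * (32 * (qc + 3 / 2) ^ 3 * W * Y₀ * (K₂ / ((bandBounds (show (-4 : ℝ) < -1.1 by norm_num) (show (-1.1 : ℝ) ≤ -0.1 by norm_num) (show (-0.1 : ℝ) < 0 by norm_num)).Dtmin - 2 * A)) * msD A₃ A₄ 1) /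
          (w * (bandBounds (show (-4 : ℝ) < -1.1 by norm_num) (show (-1.1 : ℝ) ≤ -0.1 by norm_num) (show (-0.1 : ℝ) < 0 by norm_num)).umin ^ 2 / 2)) * (2 * (Γ' / ((s₀) / 2)) ^ (1 / 4 : ℝ)) * (8 * Real.sqrt (ℓ))))
      (ℓ * max (2 * hi * ((L) * (W * Y₀ * (4 / d₁ ^ 2))))
        (W * ((Y₀ * ((K₂ * msD A₃ A₄ 1 ^ 2 + K₁ * msD A₃ A₄ 2) / lam ^ 2) + (Y₁ + Y₀ * B₁) * lam⁻¹) * (lam⁻¹ * (4 * Real.sqrt K₀))) * (4 * Real.sqrt hi)))) := by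
  set Bnd := (max (max (2 * ((2 * (      3 * W * ((4 + 2 * (3 / 2 : ℝ) + 1 / 2) / (1 / 2)) *
          (Y₀ * (4 / Real.sqrt (2 * (K₂ * msD A₃ A₄ 1 ^ 2) +
                    w * (bandBounds (show (-4 : ℝ) < -1.1 by norm_num) (show (-1.1 : ℝ) ≤ -0.1 by norm_num) (show (-0.1 : ℝ) < 0 by norm_num)).umin ^ 2) +
                  16 * Real.sqrt (2 * (K₂ * msD A₃ A₄ 1 ^ 2) +
                        w * (bandBounds (show (-4 : ℝ) < -1.1 by norm_num) (show (-1.1 : ℝ) ≤ -0.1 by norm_num) (show (-0.1 : ℝ) < 0 by norm_num)).umin ^ 2) /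
                      (w * (bandBounds (show (-4 : ℝ) < -1.1 by norm_num) (show (-1.1 : ℝ) ≤ -0.1 by norm_num) (show (-0.1 : ℝ) < 0 by norm_num)).umin ^ 2) +
                  64 * (2 * (K₂ * msD A₃ A₄ 1 ^ 2) +
                          w * (bandBounds (show (-4 : ℝ) < -1.1 by norm_num) (show (-1.1 : ℝ) ≤ -0.1 by norm_num) (show (-0.1 : ℝ) < 0 by norm_num)).umin ^ 2) ^ 2 *
                      Real.sqrt (2 * (K₂ * msD A₃ A₄ 1 ^ 2) +
                          w * (bandBounds (show (-4 : ℝ) < -1.1 by norm_num) (show (-1.1 : ℝ) ≤ -0.1 by norm_num) (show (-0.1 : ℝ) < 0 by norm_num)).umin ^ 2) /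
                    (w * (bandBounds (show (-4 : ℝ) < -1.1 by norm_num) (show (-1.1 : ℝ) ≤ -0.1 by norm_num) (show (-0.1 : ℝ) < 0 by norm_num)).umin ^ 2) ^ 3) *
              Real.sqrt (4 + 2 * (3 / 2 : ℝ) + 1 / 2) +
            32 * (Y₁ + Y₀ * B₁) * (2 * (K₂ * msD A₃ A₄ 1 ^ 2) +
                  w * (bandBounds (show (-4 : ℝ) < -1.1 by norm_num) (show (-1.1 : ℝ) ≤ -0.1 by norm_num) (show (-0.1 : ℝ) < 0 by norm_num)).umin ^ 2) /
              (w * (bandBounds (show (-4 : ℝ) < -1.1 by norm_num) (show (-1.1 : ℝ) ≤ -0.1 by norm_num) (show (-0.1 : ℝ) < 0 by norm_num)).umin ^ 2) ^ 2))) * max 1 (Real.sqrt (κ₀))⁻¹ * (81 * (Γ / (κ₀)) ^ (1 / 4 : ℝ)) *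
          ((ℓ) ^ (3 / 4 : ℝ) / (3 / 4) + (ℓ) ^ (1 / 4 : ℝ) / (1 / 4))))
      ((8 * (32 * (Y₀ * Afl + W * Y₀ * Ct + 5 * (W * Y₀ * Mρ) + 32 * (W * Y₀)) / (3 * Real.sqrt (w * (bandBounds (show (-4 : ℝ) < -1.1 by norm_num) (show (-1.1 : ℝ) ≤ -0.1 by norm_num) (show (-0.1 : ℝ) < 0 by norm_num)).umin ^ 2 / 2))) + 4 * (2 * (      W * (Y₀ * (4 / Real.sqrt (2 * (K₂ * msD A₃ A₄ 1 ^ 2) +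
                    w * (bandBounds (show (-4 : ℝ) < -1.1 by norm_num) (show (-1.1 : ℝ) ≤ -0.1 by norm_num) (show (-0.1 : ℝ) < 0 by norm_num)).umin ^ 2) + 16 * Real.sqrt (2 * (K₂ * msD A₃ A₄ 1 ^ 2) +
                    w * (bandBounds (show (-4 : ℝ) < -1.1 by norm_num) (show (-1.1 : ℝ) ≤ -0.1 by norm_num) (show (-0.1 : ℝ) < 0 by norm_num)).umin ^ 2) / (w * (bandBounds (show (-4 : ℝ) < -1.1 by norm_num) (show (-1.1 : ℝ) ≤ -0.1 by norm_num) (show (-0.1 : ℝ) < 0 by norm_num)).umin ^ 2) + 64 * (2 * (K₂ * msD A₃ A₄ 1 ^ 2) +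
                    w * (bandBounds (show (-4 : ℝ) < -1.1 by norm_num) (show (-1.1 : ℝ) ≤ -0.1 by norm_num) (show (-0.1 : ℝ) < 0 by norm_num)).umin ^ 2) ^ 2 * Real.sqrt (2 * (K₂ * msD A₃ A₄ 1 ^ 2) +
                    w * (bandBounds (show (-4 : ℝ) < -1.1 by norm_num) (show (-1.1 : ℝ) ≤ -0.1 by norm_num) (show (-0.1 : ℝ) < 0 by norm_num)).umin ^ 2) / (w * (bandBounds (show (-4 : ℝ) < -1.1 by norm_num) (show (-1.1 : ℝ) ≤ -0.1 by norm_num) (show (-0.1 : ℝ) < 0 by norm_num)).umin ^ 2) ^ 3 +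
              2 * Real.sqrt (w * (bandBounds (show (-4 : ℝ) < -1.1 by norm_num) (show (-1.1 : ℝ) ≤ -0.1 by norm_num) (show (-0.1 : ℝ) < 0 by norm_num)).umin ^ 2) / (w * (bandBounds (show (-4 : ℝ) < -1.1 by norm_num) (show (-1.1 : ℝ) ≤ -0.1 by norm_num) (show (-0.1 : ℝ) < 0 by norm_num)).umin ^ 2) + (2 * (K₂ * msD A₃ A₄ 1 ^ 2) +
                    w * (bandBounds (show (-4 : ℝ) < -1.1 by norm_num) (show (-1.1 : ℝ) ≤ -0.1 by norm_num) (show (-0.1 : ℝ) < 0 by norm_num)).umin ^ 2) * Real.sqrt (w * (bandBounds (show (-4 : ℝ) < -1.1 by norm_num) (show (-1.1 : ℝ) ≤ -0.1 by norm_num) (show (-0.1 : ℝ) < 0 by norm_num)).umin ^ 2) / (w * (bandBounds (show (-4 : ℝ) < -1.1 by norm_num) (show (-1.1 : ℝ) ≤ -0.1 by norm_num) (show (-0.1 : ℝ) < 0 by norm_num)).umin ^ 2) ^ 2) +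
            (Y₁ + Y₀ * B₁) * (32 * (2 * (K₂ * msD A₃ A₄ 1 ^ 2) +
                    w * (bandBounds (show (-4 : ℝ) < -1.1 by norm_num) (show (-1.1 : ℝ) ≤ -0.1 by norm_num) (show (-0.1 : ℝ) < 0 by norm_num)).umin ^ 2) * Real.sqrt (K₀ + hi) / (w * (bandBounds (show (-4 : ℝ) < -1.1 by norm_num) (show (-1.1 : ℝ) ≤ -0.1 by norm_num) (show (-0.1 : ℝ) < 0 by norm_num)).umin ^ 2) ^ 2 + (L + 2 * Wm) * Real.sqrt (w * (bandBounds (show (-4 : ℝ) < -1.1 by norm_num) (show (-1.1 : ℝ) ≤ -0.1 by norm_num) (show (-0.1 : ℝ) < 0 by norm_num)).umin ^ 2) / (w * (bandBounds (show (-4 : ℝ) < -1.1 by norm_num) (show (-1.1 : ℝ) ≤ -0.1 by norm_num) (show (-0.1 : ℝ) < 0 by norm_num)).umin ^ 2))) *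
          ((4 + 2 * (3 / 2 : ℝ) + 1 / 2) * Real.sqrt (4 + 2 * (3 / 2 : ℝ) + 1 / 2) *
                ((1 + Real.log 2 + log⁺ ((1 + 4 * (2 * (K₂ * msD A₃ A₄ 1 ^ 2) +
                    w * (bandBounds (show (-4 : ℝ) < -1.1 by norm_num) (show (-1.1 : ℝ) ≤ -0.1 by norm_num) (show (-0.1 : ℝ) < 0 by norm_num)).umin ^ 2) / (w * (bandBounds (show (-4 : ℝ) < -1.1 by norm_num) (show (-1.1 : ℝ) ≤ -0.1 by norm_num) (show (-0.1 : ℝ) < 0 by norm_num)).umin ^ 2)) * (1 + (3 / 2 : ℝ))) + log⁺ (1 + 4 * (2 * (K₂ * msD A₃ A₄ 1 ^ 2) +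
                    w * (bandBounds (show (-4 : ℝ) < -1.1 by norm_num) (show (-1.1 : ℝ) ≤ -0.1 by norm_num) (show (-0.1 : ℝ) < 0 by norm_num)).umin ^ 2) / (w * (bandBounds (show (-4 : ℝ) < -1.1 by norm_num) (show (-1.1 : ℝ) ≤ -0.1 by norm_num) (show (-0.1 : ℝ) < 0 by norm_num)).umin ^ 2))) + 4) +
            2 * (1 + Real.log 2 + log⁺ ((1 + 4 * (2 * (K₂ * msD A₃ A₄ 1 ^ 2) +
                    w * (bandBounds (show (-4 : ℝ) < -1.1 by norm_num) (show (-1.1 : ℝ) ≤ -0.1 by norm_num) (show (-0.1 : ℝ) < 0 by norm_num)).umin ^ 2) / (w * (bandBounds (show (-4 : ℝ) < -1.1 by norm_num) (show (-1.1 : ℝ) ≤ -0.1 by norm_num) (show (-0.1 : ℝ) < 0 by norm_num)).umin ^ 2)) * (1 + (3 / 2 : ℝ))) + log⁺ (1 + 4 * (2 * (K₂ * msD A₃ A₄ 1 ^ 2) +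
                    w * (bandBounds (show (-4 : ℝ) < -1.1 by norm_num) (show (-1.1 : ℝ) ≤ -0.1 by norm_num) (show (-0.1 : ℝ) < 0 by norm_num)).umin ^ 2) / (w * (bandBounds (show (-4 : ℝ) < -1.1 by norm_num) (show (-1.1 : ℝ) ≤ -0.1 by norm_num) (show (-0.1 : ℝ) < 0 by norm_num)).umin ^ 2))) *
              ((4 + 2 * (3 / 2 : ℝ) + 1 / 2) / (1 / 2) * Real.sqrt ((4 + 2 * (3 / 2 : ℝ) + 1 / 2) / (1 / 2))))))) / Real.sqrt ((s₀) / 2) + (((16 * (qc + 3 / 2) ^ 3 * W * Y₀ * (K₂ / ((bandBounds (show (-4 : ℝ) < -1.1 by norm_num) (show (-1.1 : ℝ) ≤ -0.1 by norm_num) (show (-0.1 : ℝ) < 0 by norm_num)).Dtmin - 2 * A)) * (1 / ((bandBounds (show (-4 : ℝ) < -1.1 by norm_num) (show (-1.1 : ℝ) ≤ -0.1 by norm_num) (show (-0.1 : ℝ) < 0 by norm_num)).Dtmin - 2 * A) + msD A₃ A₄ 1 * (π * (4 + 2 * A) * Kc / ((bandBounds (show (-4 : ℝ) < -1.1 by norm_num)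 (show (-1.1 : ℝ) ≤ -0.1 by norm_num) (show (-0.1 : ℝ) < 0 by norm_num)).umin * w * ((bandBounds (show (-4 : ℝ) < -1.1 by norm_num) (show (-1.1 : ℝ) ≤ -0.1 by norm_num) (show (-0.1 : ℝ) < 0 by norm_num)).Dtmin - 2 * A) ^ 2))) + 128 * (qc + 3 / 2) ^ 3 * W * Y₀ * (K₂ / ((bandBounds (show (-4 : ℝ) < -1.1 by norm_num) (show (-1.1 : ℝ) ≤ -0.1 by norm_num) (show (-0.1 : ℝ) < 0 by norm_num)).Dtmin - 2 * A) ^ 2) + 16 * (qc + 3 / 2) ^ 2 * W * YL + Y₀ * Bfl) * (L + 2 * Wm) +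
          8 * (32 * (qc + 3 / 2) ^ 3 * W * Y₀ * (K₂ / ((bandBounds (show (-4 : ℝ) < -1.1 by norm_num) (show (-1.1 : ℝ) ≤ -0.1 by norm_num) (show (-0.1 : ℝ) < 0 by norm_num)).Dtmin - 2 * A)) * msD A₃ A₄ 1) /
            (w * (bandBounds (show (-4 : ℝ) < -1.1 by norm_num) (show (-1.1 : ℝ) ≤ -0.1 by norm_num) (show (-0.1 : ℝ) < 0 by norm_num)).umin ^ 2 / 2) * Real.log 2)) * (ℓ) +
        (4 * (32 * (qc + 3 / 2) ^ 3 * W * Y₀ * (K₂ / ((bandBounds (show (-4 : ℝ) < -1.1 by norm_num) (show (-1.1 : ℝ) ≤ -0.1 by norm_num) (show (-0.1 : ℝ) < 0 by norm_num)).Dtmin - 2 * A)) * msD A₃ A₄ 1) /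
          (w * (bandBounds (show (-4 : ℝ) < -1.1 by norm_num) (show (-1.1 : ℝ) ≤ -0.1 by norm_num) (show (-0.1 : ℝ) < 0 by norm_num)).umin ^ 2 / 2)) * (2 * (Γ' / ((s₀) / 2)) ^ (1 / 4 : ℝ)) * (8 * Real.sqrt (ℓ))))
      (ℓ * max (2 * hi * ((L) * (W * Y₀ * (4 / d₁ ^ 2))))
        (W * ((Y₀ * ((K₂ * msD A₃ A₄ 1 ^ 2 + K₁ * msD A₃ A₄ 2) / lam ^ 2) + (Y₁ + Y₀ * B₁) * lam⁻¹) * (lam⁻¹ * (4 * Real.sqrt K₀))) * (4 * Real.sqrt hi)))) with hBnd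
  have hπ := Real.pi_pos
  have hDt : 0 < (bandBounds (show (-4 : ℝ) < -1.1 by norm_num) (show (-1.1 : ℝ) ≤ -0.1 by norm_num) (show (-0.1 : ℝ) < 0 by norm_num)).Dtmin - 2 * A := by
    have := klCurveD_pos; linarith only [this, hd]
  have hu : 0 < (bandBounds (show (-4 : ℝ) < -1.1 by norm_num) (show (-1.1 : ℝ) ≤ -0.1 by norm_num) (show (-0.1 : ℝ) < 0 by norm_num)).umin :=
    (bandBounds (show (-4 : ℝ) < -1.1 by norm_num) (show (-1.1 : ℝ) ≤ -0.1 by norm_num) (show (-0.1 : ℝ) < 0 by norm_num)).umin_pos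
  have hwp : 0 < w := hG.wmin_pos
  have hA0 : 0 ≤ A := (norm_nonneg _).trans (hA 0 0 (by norm_num))
  have hKc0 : 0 ≤ Kc := (norm_nonneg _).trans (hG.norm_iteratedFDeriv_le 0 0 (by norm_num))
  have hK₁0 : 0 ≤ K₁ := (norm_nonneg _).trans (hK₁ 0)
  have hK₂0 : 0 ≤ K₂ := (norm_nonneg _).trans (hK₂ 0)
  have hK₃0 : 0 ≤ K₃ := (norm_nonneg _).trans (hK₃ 0)
  have hD1 : 0 < msD A₃ A₄ 1 := msD_one_pos A₃ A₄
  have hD2 : 0 ≤ msD A₃ A₄ 2 := (msD_two_pos A₃ A₄).le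
  have hhi0 : 0 ≤ hi := hlo0.le.trans hlohi
  have hhh : -hi ≤ hi := by linarith only [hhi0]
  have hqc0 : 0 < qc := by linarith only [hqc]
  have hlog2 : 0 < Real.log 2 := Real.log_pos (by norm_num)
  have hΓ0 : 0 < Γ := hK₀pos.trans_le hΓ₁
  have hΓ'0 : 0 < Γ' := hK₀pos.trans_le hΓ'₁
  have hX₁ : 0 ≤ Y₁ + Y₀ * B₁ := by positivity
  have hNt : (0 : ℝ) ≤ Nt := Nat.cast_nonneg Nt
  have hαβ : α₀ ≤ α₀ + Nt * ℓ := le_add_of_nonneg_right (mul_nonneg hNt hℓ)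
  set L₁ := log⁺ ((1 + 4 * (2 * (K₂ * msD A₃ A₄ 1 ^ 2) + w * (bandBounds (show (-4 : ℝ) < -1.1 by norm_num) (show (-1.1 : ℝ) ≤ -0.1 by norm_num) (show (-0.1 : ℝ) < 0 by norm_num)).umin ^ 2) / (w * (bandBounds (show (-4 : ℝ) < -1.1 by norm_num) (show (-1.1 : ℝ) ≤ -0.1 by norm_num) (show (-0.1 : ℝ) < 0 by norm_num)).umin ^ 2)) * (1 + (3 / 2 : ℝ))) with hL₁
  set L₂ := log⁺ (1 + 4 * (2 * (K₂ * msD A₃ A₄ 1 ^ 2) + w * (bandBounds (show (-4 : ℝ) < -1.1 by norm_num) (show (-1.1 : ℝ) ≤ -0.1 by norm_num) (show (-0.1 : ℝ) < 0 by norm_num)).umin ^ 2) / (w * (bandBounds (show (-4 : ℝ) < -1.1 by norm_num) (show (-1.1 : ℝ) ≤ -0.1 by norm_num) (show (-0.1 : ℝ) < 0 by norm_num)).umin ^ 2)) with hL₂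
  have hL₁0 : 0 ≤ L₁ := Real.posLog_nonneg
  have hL₂0 : 0 ≤ L₂ := Real.posLog_nonneg
  -- §1 each window: rows of `X_j = Y·χ_j`, window rows at its own length, bound monotone in the length
  have hwin_le : ∀ j < J, ∫ ϑ in α₀..(α₀ + Nt * ℓ), |∫ e in (-hi)..hi, ∫ v in (φa j)..(φb j),
      wt e * ((fun ϑ e v => Y ϑ e v * χ j v) ϑ e v * deriv (Kr e) (frameLevel μ K (pairSumPath μ K ρ ϑ θ 0 - levelPoint μ K e (v + θ))))| ≤ (Nt : ℝ) * Bnd := by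
    intro j hj
    obtain ⟨hφj, hLj⟩ := hwin j hj
    have hlen0 : 0 ≤ φb j - φa j := sub_nonneg.2 hφj
    have hWφj : φb j - φa j + 2 * Wm ≤ Wφ := by linarith only [hLj, hWφ]
    have hΓ'₂j : w * (bandBounds (show (-4 : ℝ) < -1.1 by norm_num) (show (-1.1 : ℝ) ≤ -0.1 by norm_num) (show (-0.1 : ℝ) < 0 by norm_num)).umin ^ 2 / 2 * (φb j - φa j + 2 * Wm) ^ 2 ≤ Γ' := by
      have h1 : (φb j - φa j + 2 * Wm) ^ 2 ≤ (L + 2 * Wm) ^ 2 := pow_le_pow_left₀ (by linarith only [hlen0, hWm]) (by linarith only [hLj]) 2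
      have h2 := mul_le_mul_of_nonneg_left h1 (show 0 ≤ w * (bandBounds (show (-4 : ℝ) < -1.1 by norm_num) (show (-1.1 : ℝ) ≤ -0.1 by norm_num) (show (-0.1 : ℝ) < 0 by norm_num)).umin ^ 2 / 2 by positivity)
      exact h2.trans hΓ'₂
    have hΔcj : τ₀ + msD A₃ A₄ 1 * (ℓ + (φb j - φa j + 2 * Wm)) ≤ Δc := by
      have h1 : msD A₃ A₄ 1 * (ℓ + (φb j - φa j + 2 * Wm)) ≤ msD A₃ A₄ 1 * (ℓ + (L + 2 * Wm)) :=
        mul_le_mul_of_nonneg_left (by linarith only [hLj]) hD1.le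
      linarith only [h1, hΔc]
    have hω₂j : φb j - φa j + 2 * Wm ≤ ω := by linarith only [hLj, hω₂]
    have hepsj : d₁ + K₁ * (msD A₃ A₄ 1 * (φb j - φa j)) + K₁ * (hi / ((bandBounds (show (-4 : ℝ) < -1.1 by norm_num) (show (-1.1 : ℝ) ≤ -0.1 by norm_num) (show (-0.1 : ℝ) < 0 by norm_num)).Dtmin - 2 * A)) + hi ≤ eps := by
      have h1 : K₁ * (msD A₃ A₄ 1 * (φb j - φa j)) ≤ K₁ * (msD A₃ A₄ 1 * L) :=
        mul_le_mul_of_nonneg_left (mul_le_mul_of_nonneg_left hLj hD1.le) hK₁0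
      linarith only [h1, heps]
    have hXdj : ∀ ϑ, ∀ e ∈ Icc (-hi) hi, ContDiff ℝ 1 ((fun ϑ e v => Y ϑ e v * χ j v) ϑ e) := fun ϑ e he => (hYd ϑ e he).mul (hχd j hj)
    have hX3j : ContinuousOn (fun p : ℝ × ℝ × ℝ => (fun ϑ e v => Y ϑ e v * χ j v) p.1 p.2.1 p.2.2) (univ ×ˢ (Icc (-hi) hi ×ˢ univ)) :=
      hY3.mul ((hχd j hj).continuous.comp (continuous_snd.comp continuous_snd)).continuousOn
    have hXsj : ∀ ϑ, ∀ e ∈ Icc (-hi) hi, tsupport ((fun ϑ e v => Y ϑ e v * χ j v) ϑ e) ⊆ Ioo (φa j) (φb j) := fun ϑ e _ =>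
      (tsupport_mul_subset_right (f := Y ϑ e) (g := χ j)).trans (hχs j hj)
    have hXbj : ∀ ϑ, ∀ e ∈ Icc (-hi) hi, ∀ v, |(fun ϑ e v => Y ϑ e v * χ j v) ϑ e v| ≤ Y₀ := fun ϑ e he v => abs_mul_bump_le (hYb ϑ e he) (hχb j hj) v
    have hX₁bj : ∀ ϑ, ∀ e ∈ Icc (-hi) hi, ∀ v, |deriv ((fun ϑ e v => Y ϑ e v * χ j v) ϑ e) v| ≤ Y₁ + Y₀ * B₁ := fun ϑ e he v =>
      abs_deriv_mul_bump_le (hYd ϑ e he) (hχd j hj) (hYb ϑ e he) (hY1 ϑ e he) (hχb j hj) (hχ1 j hj) v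
    have hXLipj : ∀ ϑ, ∀ e ∈ Icc lo hi, ∀ v, |(fun ϑ e v => Y ϑ e v * χ j v) ϑ e v - (fun ϑ e v => Y ϑ e v * χ j v) ϑ lo v| ≤ YL * |e - lo| := by
      intro ϑ e he v
      have h1 := hYLip ϑ e he v
      have h2 := hχb j hj v
      have e1 : Y ϑ e v * χ j v - Y ϑ lo v * χ j v = (Y ϑ e v - Y ϑ lo v) * χ j v := by ring
      show |Y ϑ e v * χ j v - Y ϑ lo v * χ j v| ≤ YL * |e - lo|
      rw [e1, abs_mul]
      have h3 : 0 ≤ YL * |e - lo| := by positivity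
      nlinarith only [h1, h2, h3, abs_nonneg (Y ϑ e v - Y ϑ lo v), abs_nonneg (χ j v)]
    -- the null rows of the bumped numerator and the direct-null threshold at this window length
    have hXnullj : ∀ ϑ ∈ Icc α₀ (α₀ + Nt * ℓ), ∀ e ∈ Icc (-hi) hi, ∀ v,
        ‖pairSumPath μ K ρ ϑ θ 0 - (2 : ℝ) • levelPoint μ K 0 (v + θ)‖ ≤ τ₁ → (fun ϑ e v => Y ϑ e v * χ j v) ϑ e v = 0 :=
      fun ϑ hϑ e he v hv => by simp only [hYnull ϑ hϑ e he v hv, zero_mul]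
    have hCnullj : ∀ ϑ ∈ Icc α₀ (α₀ + Nt * ℓ), ∀ e ∈ Icc (-hi) hi, ∀ v,
        ‖pairSumPath μ K ρ ϑ θ 0‖ ≤ s₁ → (fun ϑ e v => Y ϑ e v * χ j v) ϑ e v = 0 :=
      fun ϑ hϑ e he v hv => by simp only [hCnull ϑ hϑ e he v hv, zero_mul]
    have hτ₁j : τ₀ + msD A₃ A₄ 1 * (ℓ + 2 * (φb j - φa j)) ≤ τ₁ := by
      have h1 : msD A₃ A₄ 1 * (ℓ + 2 * (φb j - φa j)) ≤ msD A₃ A₄ 1 * (ℓ + 2 * L) :=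
        mul_le_mul_of_nonneg_left (by linarith only [hLj]) hD1.le
      linarith only [h1, hτ₁]
    have h := umkArc_integral_middle_le_unif hA hA20 hd hr hlo hhi hA₃ hA₄ hK₁ hK₂ hK₃ hF hG hρ hρ₀ θ (Nt := Nt) (α₀ := α₀) (ℓ := ℓ) (φa := φa j) (φb := φb j)
        (τ₀ := τ₀) (lo := lo) (hi := hi) (Wφ := Wφ) (Wm := Wm) (qc := qc) (Ct := Ct) (Δ := Δ) (K₀ := K₀) (X₀ := Y₀) (X₁ := Y₁ + Y₀ * B₁) (XL := YL) (W := W)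
        (Afl := Afl) (Bfl := Bfl) (Dfl := Dfl) (Mρ := Mρ) (Γ := Γ) (Γ' := Γ') (η₀ := η₀) (Δc := Δc) (ω := ω) (d₁ := d₁) (lam := lam) (eps := eps)
        (κ₀ := κ₀) (s₀ := s₀) (Kr := Kr) (X := fun ϑ e v => Y ϑ e v * χ j v) (wt := wt) (ρm := ρm)
        hℓ hφj hWm hMρ hWφj hmod hsl hrt hlo0 hlohi hhir hqc hCt hY₀ hX₁ hYL hW hAfl hBfl hK₀ hK₀pos hΓ₁ hΓ₂ hΓ'₁ hΓ'₂j hΔ hΔ1 hΔu hΔr hDfl hKd hK2d hK0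
        hK0s hK1 hK2 hcomp hKopp hKc hflatB hKn1 hρ0 hρc hρtail hKs1 hXdj hX3j hXsj hXbj hX₁bj hXLipj hwc hw0 hwW hsame hΔcj hΔc1 hΔcr hω₁ hω₂j hΓ hhir₀
        hhiK hd₁ hlam hhid hepsj hepsr hT hτ₀ hτ₁j hXnullj hs₁ hCnullj hκ₀ hκ₀le hs₀ hs₀le
    refine h.trans ?_
    rw [hBnd]
    gcongr
  -- §2 the loop circle is the sum of the windows, at every `(ϑ, e)`
  have hsplit : ∀ ϑ : ℝ, ∀ e ∈ Icc (-hi) hi,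
      ∫ v in v₀..(v₀ + 2 * π), wt e * (Y ϑ e v * deriv (Kr e) (frameLevel μ K (pairSumPath μ K ρ ϑ θ 0 - levelPoint μ K e (v + θ)))) =
      ∑ j ∈ Finset.range J, ∫ v in (φa j)..(φb j),
        wt e * ((fun ϑ e v => Y ϑ e v * χ j v) ϑ e v * deriv (Kr e) (frameLevel μ K (pairSumPath μ K ρ ϑ θ 0 - levelPoint μ K e (v + θ)))) := by
    intro ϑ e he
    have her : |e| < r := abs_lt.2 ⟨by linarith only [he.1, hhir], lt_of_le_of_lt he.2 hhir⟩
    have hLc : Continuous fun v : ℝ => levelPoint μ K e (v + θ) :=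
      (contDiff_levelPoint_of_sizes hA hd hlo hhi her 0).continuous.comp (continuous_id.add continuous_const)
    have hfl : Continuous (frameLevel μ K) := (EngineV8.contDiff_frameLevel μ K (n := 0)).continuous
    have hKe : Continuous fun u : ℝ => deriv (Kr e) u := hKc.comp (continuous_const.prodMk continuous_id)
    have hg : Continuous fun v : ℝ => wt e * (Y ϑ e v * deriv (Kr e) (frameLevel μ K (pairSumPath μ K ρ ϑ θ 0 - levelPoint μ K e (v + θ)))) :=
      continuous_const.mul ((hYd ϑ e he).continuous.mul (hKe.comp (hfl.comp (continuous_const.sub hLc))))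
    have hper : ∀ v : ℝ, wt e * (Y ϑ e (v + 2 * π) * deriv (Kr e) (frameLevel μ K (pairSumPath μ K ρ ϑ θ 0 - levelPoint μ K e (v + 2 * π + θ)))) =
        wt e * (Y ϑ e v * deriv (Kr e) (frameLevel μ K (pairSumPath μ K ρ ϑ θ 0 - levelPoint μ K e (v + θ)))) := fun v => by
      rw [show v + 2 * π + θ = v + θ + 2 * π by ring, levelPoint_add_two_pi, hYper ϑ e he v]
    have hmain := intervalIntegral_period_eq_sum_windows
      (g := fun v => wt e * (Y ϑ e v * deriv (Kr e) (frameLevel μ K (pairSumPath μ K ρ ϑ θ 0 - levelPoint μ K e (v + θ))))) hg hper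
      (fun j hj => (hχd j hj).continuous) hχs hwinI hsum
    rw [hmain]
    refine Finset.sum_congr rfl fun j _ => intervalIntegral.integral_congr fun v _ => ?_
    simp only
    ring
  -- §3 pointwise: `F_circle(ϑ) ≤ ∑_j F_j(ϑ)`
  have hIj : ∀ ϑ : ℝ, ∀ j < J, IntervalIntegrable (fun e => ∫ v in (φa j)..(φb j),
      wt e * ((fun ϑ e v => Y ϑ e v * χ j v) ϑ e v * deriv (Kr e) (frameLevel μ K (pairSumPath μ K ρ ϑ θ 0 - levelPoint μ K e (v + θ))))) volume (-hi) hi := by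
    intro ϑ j hj
    have hX2' : ContinuousOn (fun p : ℝ × ℝ => wt p.1 * (Y ϑ p.1 p.2 * χ j p.2)) (Icc (-hi) hi ×ˢ univ) :=
      (hwc.comp continuous_fst.continuousOn fun p hp => (mem_prod.1 hp).1).mul
        ((continuousOn_slice_of_continuousOn₃ hY3 ϑ).mul ((hχd j (by exact hj)).continuous.comp continuous_snd).continuousOn)
    have hc := Literature.Analysis.FluidPDE.continuousOn_parametric_intervalIntegral
      (continuousOn_box_integrand hA hd hlo hhi (pairSumPath μ K ρ ϑ θ 0) θ hhir (X := fun e v => wt e * (Y ϑ e v * χ j v)) hX2' hKc) (φa j) (φb j)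
    refine (ContinuousOn.intervalIntegrable ?_)
    rw [uIcc_of_le hhh]
    refine hc.congr fun e _ => ?_
    refine intervalIntegral.integral_congr fun v _ => ?_
    simp only
    ring
  have hpt : ∀ ϑ : ℝ, |∫ e in (-hi)..hi, ∫ v in v₀..(v₀ + 2 * π), wt e * (Y ϑ e v * deriv (Kr e) (frameLevel μ K (pairSumPath μ K ρ ϑ θ 0 - levelPoint μ K e (v + θ))))| ≤
      ∑ j ∈ Finset.range J, |∫ e in (-hi)..hi, ∫ v in (φa j)..(φb j),
        wt e * ((fun ϑ e v => Y ϑ e v * χ j v) ϑ e v * deriv (Kr e) (frameLevel μ K (pairSumPath μ K ρ ϑ θ 0 - levelPoint μ K e (v + θ))))| := by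
    intro ϑ
    rw [intervalIntegral.integral_congr fun e he => hsplit ϑ e (by rwa [uIcc_of_le hhh] at he),
      intervalIntegral.integral_finsetSum fun j hj => hIj ϑ j (Finset.mem_range.1 hj)]
    exact Finset.abs_sum_le_sum_abs _ _
  -- §4 integrate over the arc and sum the window bounds
  have hFj : ∀ j < J, Continuous fun ϑ => |∫ e in (-hi)..hi, ∫ v in (φa j)..(φb j),
      wt e * ((fun ϑ e v => Y ϑ e v * χ j v) ϑ e v * deriv (Kr e) (frameLevel μ K (pairSumPath μ K ρ ϑ θ 0 - levelPoint μ K e (v + θ))))| := by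
    intro j hj
    have hX3j : ContinuousOn (fun p : ℝ × ℝ × ℝ => (fun ϑ e v => Y ϑ e v * χ j v) p.1 p.2.1 p.2.2) (univ ×ˢ (Icc (-hi) hi ×ˢ univ)) :=
      hY3.mul ((hχd j hj).continuous.comp (continuous_snd.comp continuous_snd)).continuousOn
    exact continuous_boxAbsIntegral_cfg hA hd hlo hhi hρ θ hhi0 hhir hX3j hKc hwc
  have hFtot : Continuous fun ϑ => |∫ e in (-hi)..hi, ∫ v in v₀..(v₀ + 2 * π),
      wt e * (Y ϑ e v * deriv (Kr e) (frameLevel μ K (pairSumPath μ K ρ ϑ θ 0 - levelPoint μ K e (v + θ))))| :=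
    continuous_boxAbsIntegral_cfg hA hd hlo hhi hρ θ hhi0 hhir hY3 hKc hwc
  have hsumc : Continuous fun ϑ => ∑ j ∈ Finset.range J, |∫ e in (-hi)..hi, ∫ v in (φa j)..(φb j),
      wt e * ((fun ϑ e v => Y ϑ e v * χ j v) ϑ e v * deriv (Kr e) (frameLevel μ K (pairSumPath μ K ρ ϑ θ 0 - levelPoint μ K e (v + θ))))| :=
    continuous_finsetSum _ fun j hj => hFj j (Finset.mem_range.1 hj)
  calc ∫ ϑ in α₀..(α₀ + Nt * ℓ), |∫ e in (-hi)..hi, ∫ v in v₀..(v₀ + 2 * π),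
          wt e * (Y ϑ e v * deriv (Kr e) (frameLevel μ K (pairSumPath μ K ρ ϑ θ 0 - levelPoint μ K e (v + θ))))|
      ≤ ∫ ϑ in α₀..(α₀ + Nt * ℓ), ∑ j ∈ Finset.range J, |∫ e in (-hi)..hi, ∫ v in (φa j)..(φb j),
          wt e * ((fun ϑ e v => Y ϑ e v * χ j v) ϑ e v * deriv (Kr e) (frameLevel μ K (pairSumPath μ K ρ ϑ θ 0 - levelPoint μ K e (v + θ))))| :=
        intervalIntegral.integral_mono_on hαβ (hFtot.intervalIntegrable _ _) (hsumc.intervalIntegrable _ _) fun ϑ _ => hpt ϑ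
    _ = ∑ j ∈ Finset.range J, ∫ ϑ in α₀..(α₀ + Nt * ℓ), |∫ e in (-hi)..hi, ∫ v in (φa j)..(φb j),
          wt e * ((fun ϑ e v => Y ϑ e v * χ j v) ϑ e v * deriv (Kr e) (frameLevel μ K (pairSumPath μ K ρ ϑ θ 0 - levelPoint μ K e (v + θ))))| :=
        intervalIntegral.integral_finsetSum fun j hj => (hFj j (Finset.mem_range.1 hj)).intervalIntegrable _ _
    _ ≤ ∑ _j ∈ Finset.range J, (Nt : ℝ) * Bnd := Finset.sum_le_sum fun j hj => hwin_le j (Finset.mem_range.1 hj)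
    _ = (J : ℝ) * ((Nt : ℝ) * Bnd) := by rw [Finset.sum_const, Finset.card_range, nsmul_eq_mul]

end Sizes

end Summit.HubbardSuperconductivity.HubbardSuperconductivity.Theorems.C4a

end
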